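import Summits.CriticalPhenomena.PercolationContinuityZ3.Theses.PercLowPointHalfSpace
import Summits.CriticalPhenomena.PercolationContinuityZ3.Theses.PercNonProliferation
import Summits.CriticalPhenomena.PercolationContinuityZ3.Theorems.PercLowPointHalfSpaceBoundaryTwoArmDecayStubCensus
import Summits.CriticalPhenomena.PercolationContinuityZ3.Theorems.PercLowPointHalfSpaceBoundaryTwoArmDecayStubTallDensity

/-!
# Crux `PercLowPointHalfSpace.BoundaryTwoArmDecay` (stmt-CriticalPhenomena-0911), line
# `staircase-bootstrap-floor-decoupling` — the KISSING DENSITY decays: `κ_n ≤ 2/(p_c³ n)` and, given stmt-4446,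
# `κ_n ≤ C_s n^{s-3}`

Lead file of the line (prover-line-stmt-CriticalPhenomena-0911-a5-0); lands `--supports stmt-CriticalPhenomena-0911`
(registered sub-goals `stub_kissDensitySummable`, `stub_kissDensityDecay`). Definition-free: the objects are those of
`PercLowPointHalfSpaceBoundaryTwoArmDecayStubCensusDefs.lean` (`StubCensus.kap`, `.eD`, `.nu`, `.tall`, `.PK`, `.fl`).

## Statements

At `p_c = p_c(ℤ³)`, with `ℍ = {0 ≤ x₀}`, `U = C_ℍ(0)`, the KISSING DENSITY
`κ_n = E[ 1{U n-tall and U has a partner-kiss edge (q₁ ∈ U, q₂ ∉ U adjacent floor sites, C_ℍ(q₂) n-tall)} / |U ∩ ∂ℍ| ]`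
(the density per floor site of `n`-tall wall clusters kissing ANOTHER `n`-tall wall cluster — the cluster-density
form "Â" of the crux event `A_n`) satisfies

* `stub_kissDensitySummable` (UNCONDITIONAL): `κ_n ≤ 2 / (p_c³ · n)` for every `n ≥ 1`;
* `stub_kissDensityDecay` (given `SubpolynomialBlocking` = stmt-CriticalPhenomena-4446): for every `s > 0`,
  `κ_n ≤ C_s n^{s-3}` for every `n ≥ 1` — exponent `3 - s`, above the crux threshold `5/2`.

So the MERGER/KISSING-density weakening Â of crux A holds with the sharp predicted exponent `3 = d` up to `n^{s}`,
conditional on the non-proliferation crux 4446 ALONE (no floor decoupling Q, no confinement Q_conf, no slab input);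
what separates Â from A itself is only the number `K_n` of partner-kiss edges per kissing cluster (triage r2 (d)).

## Proof

The census files give `p_c³ κ_n ≤ X_n ≤ 2 e_n` (`StubCensus.kap_le_X`, `StubCensus.X_le_two_eD`: staple + level
census), `ν_n = e_n + ν_{n+1}` (`StubCensus.nu_eq`) and `ν_n ≤ 1`; hence `Σ_{m=N}^{M} e_m ≤ ν_N` (telescoping) and,
`κ` being antitone in `n`, `(N+1) κ_{M} ≤ Σ_{m=N}^{M} κ_m ≤ 2 ν_N / p_c³`.  With `N = 0`, `M = n`: `κ_n ≤ 2/(p_c³ (n+1))`.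
With `M = 2N` and `stub_tallDensity` (`ν_N ≤ C_t N^{t-2}` from 4446): `κ_{2N} ≤ 2 C_t N^{t-3}/p_c³`, and odd / small `n`
by antitonicity.

Sources: G. Grimmett, *Percolation* (1999), Thm. (7.35) (BGN), §1.4; R. Lyons – Y. Peres (2016) §8.2 (mass transport) —
all through the imported census files.
-/

noncomputable section

namespace Summit.CriticalPhenomena.PercolationContinuityZ3.Theorems.BoundaryTwoArmDecay

open MeasureTheory Filter Topology
open Literature.Probability.Percolation Literature.Probability.LatticeModels
open scoped ENNReal

namespace KissDensity

open Negative (μ)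
open StubCensus (kap eD nu tall PK fl kap_le_X X_le_two_eD nu_eq nu_le_one nu_ne_top eD_ne_top tall_mono)

/-! ### `κ` is antitone, `κ ≤ ν ≤ 1` -/

/-- The partner-kiss set shrinks as the height grows. -/
theorem PK_mono {m n : ℕ} (h : m ≤ n) (a : Site 3) (ω : BondConfig (Site 3)) : PK n a ω ⊆ PK m a ω := by
  rintro q ⟨h1, h2, h3, h4, h5, h6⟩
  exact ⟨h1, h2, h3, h4, h5, tall_mono h6 h⟩

/-- The kissing event shrinks as the height grows. -/
theorem kissSet_mono {m n : ℕ} (h : m ≤ n) :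
    {ω : BondConfig (Site 3) | ω ∈ tall (halfSpace 3) n 0 ∧ (PK n 0 ω).Nonempty} ⊆
      {ω | ω ∈ tall (halfSpace 3) m 0 ∧ (PK m 0 ω).Nonempty} := by
  rintro ω ⟨ht, q, hq⟩
  exact ⟨tall_mono ht h, q, PK_mono h 0 ω hq⟩

/-- `κ` is antitone in the height. -/
theorem kap_antitone {m n : ℕ} (h : m ≤ n) : kap n ≤ kap m := by
  rw [kap, kap]
  refine lintegral_mono fun ω => ?_
  exact Set.indicator_le_indicator_of_subset (kissSet_mono h) (fun _ => bot_le) ω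

/-- `κ_n ≤ ν_n`. -/
theorem kap_le_nu (n : ℕ) : kap n ≤ nu n := by
  rw [kap, nu]
  refine lintegral_mono fun ω => ?_
  exact Set.indicator_le_indicator_of_subset (fun ω hω => hω.1) (fun _ => bot_le) ω

/-- `κ_n < ∞`. -/
theorem kap_ne_top (n : ℕ) : kap n ≠ ⊤ :=
  ne_top_of_le_ne_top (nu_ne_top n) (kap_le_nu n)

/-! ### Telescoping the level census -/

/-- `Σ_{m ∈ [N, N+L]} e_m + ν_{N+L+1} = ν_N`. -/
theorem sum_eD_add_nu (N L : ℕ) : (∑ m ∈ Finset.range (L + 1), eD (N + m)) + nu (N + L + 1) = nu N := by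
  induction L with
  | zero => simp [nu_eq N]
  | succ L ih =>
    rw [Finset.sum_range_succ, add_assoc, show N + (L + 1) = N + L + 1 by ring,
      show N + L + 1 + 1 = (N + L + 1) + 1 by ring, ← nu_eq (N + L + 1), ih]

/-- `Σ_{m ∈ [N, N+L]} e_m ≤ ν_N`. -/
theorem sum_eD_le_nu (N L : ℕ) : ∑ m ∈ Finset.range (L + 1), eD (N + m) ≤ nu N := by
  calc ∑ m ∈ Finset.range (L + 1), eD (N + m)
      ≤ (∑ m ∈ Finset.range (L + 1), eD (N + m)) + nu (N + L + 1) := le_self_add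
    _ = nu N := sum_eD_add_nu N L

/-- The cube of the critical probability, as an extended non-negative real; it is positive and finite. -/
theorem p3_pos : 0 < (criticalProbI 3 : ℝ) ^ 3 := by
  have hp : 0 < (criticalProbI 3 : ℝ) := by
    rw [coe_criticalProbI]
    exact (Grimmett1999_criticalProb_pos_lt_one_holds 3 (by norm_num)).1
  exact pow_pos hp 3

/-- **Block estimate**: `p_c³ (L+1) κ_{N+L} ≤ 2 ν_N` (antitonicity of `κ`, the staple bound `p_c³ κ_m ≤ 2 e_m`,
telescoping). -/
theorem p3_mul_kap_le (N L : ℕ) :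
    ENNReal.ofReal ((criticalProbI 3 : ℝ) ^ 3) * ((L + 1 : ℕ) * kap (N + L)) ≤ 2 * nu N := by
  calc ENNReal.ofReal ((criticalProbI 3 : ℝ) ^ 3) * ((L + 1 : ℕ) * kap (N + L))
      = ENNReal.ofReal ((criticalProbI 3 : ℝ) ^ 3) * ∑ _m ∈ Finset.range (L + 1), kap (N + L) := by
        rw [Finset.sum_const, Finset.card_range, nsmul_eq_mul]
    _ ≤ ENNReal.ofReal ((criticalProbI 3 : ℝ) ^ 3) * ∑ m ∈ Finset.range (L + 1), kap (N + m) := by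
        gcongr with m hm
        exact kap_antitone (by have := Finset.mem_range.1 hm; omega)
    _ = ∑ m ∈ Finset.range (L + 1), ENNReal.ofReal ((criticalProbI 3 : ℝ) ^ 3) * kap (N + m) := by
        rw [Finset.mul_sum]
    _ ≤ ∑ m ∈ Finset.range (L + 1), 2 * eD (N + m) :=
        Finset.sum_le_sum fun m _ => (kap_le_X (N + m)).trans (X_le_two_eD (N + m))
    _ = 2 * ∑ m ∈ Finset.range (L + 1), eD (N + m) := by rw [Finset.mul_sum]
    _ ≤ 2 * nu N := mul_le_mul' le_rfl (sum_eD_le_nu N L)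

/-- Real form of the block estimate: `(L+1) κ_{N+L} ≤ 2 ν_N / p_c³` (all quantities finite). -/
theorem kap_toReal_le (N L : ℕ) :
    ((L + 1 : ℕ) : ℝ) * (kap (N + L)).toReal ≤ 2 * (nu N).toReal / (criticalProbI 3 : ℝ) ^ 3 := by
  have h := p3_mul_kap_le N L
  have hfin : ENNReal.ofReal ((criticalProbI 3 : ℝ) ^ 3) * ((L + 1 : ℕ) * kap (N + L)) ≠ ⊤ :=
    ENNReal.mul_ne_top ENNReal.ofReal_ne_top (ENNReal.mul_ne_top (ENNReal.natCast_ne_top _) (kap_ne_top _))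
  have h2fin : 2 * nu N ≠ ⊤ := ENNReal.mul_ne_top ENNReal.ofNat_ne_top (nu_ne_top N)
  have h' := (ENNReal.toReal_le_toReal hfin h2fin).2 h
  rw [ENNReal.toReal_mul, ENNReal.toReal_mul, ENNReal.toReal_ofReal p3_pos.le, ENNReal.toReal_natCast,
    ENNReal.toReal_mul, ENNReal.toReal_ofNat] at h'
  rw [le_div_iff₀ p3_pos]
  linarith

end KissDensity

open KissDensity StubCensus in
/-- **The kissing density is summably small, unconditionally** (registered sub-goal `stub_kissDensitySummable` of
stmt-CriticalPhenomena-0911): at `p_c(ℤ³)`, for every `n ≥ 1`,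
`E[1{U n-tall and U has a partner-kiss edge}/|U ∩ ∂ℍ|] ≤ 2/(p_c³ n)` — the level census makes the densities of
kissing tall clusters summable (`Σ_m p_c³ κ_m ≤ 2 Σ_m e_m ≤ 2`), and they are antitone. -/
theorem stub_kissDensitySummable :
    ∀ n : ℕ, 1 ≤ n →
      (∫⁻ ω, {ω | (∃ y : Site 3, (n : ℤ) ≤ y 0 ∧ ω ∈ openConnIn (halfSpace 3) 0 y) ∧
            ∃ q : Site 3 × Site 3, q.1 0 = 0 ∧ q.2 0 = 0 ∧ (zdGraph 3).Adj q.1 q.2 ∧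
              ω ∈ openConnIn (halfSpace 3) 0 q.1 ∧ ω ∉ openConnIn (halfSpace 3) 0 q.2 ∧
              ∃ y : Site 3, (n : ℤ) ≤ y 0 ∧ ω ∈ openConnIn (halfSpace 3) q.2 y}.indicator
          (fun ω => (((halfSpaceFootprint ω : ℕ∞) : ENNReal))⁻¹) ω
          ∂(bondPercolation (zdGraph 3) (criticalProbI 3))) ≤
        ENNReal.ofReal (2 / ((criticalProbI 3 : ℝ) ^ 3 * n)) := by
  intro n hn
  change kap n ≤ _
  obtain ⟨L, rfl⟩ : ∃ L, n = L + 1 := ⟨n - 1, by omega⟩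
  have h := kap_toReal_le 1 L
  rw [add_comm 1 L] at h
  have hnu : (nu 1).toReal ≤ 1 := by
    have := (ENNReal.toReal_le_toReal (nu_ne_top 1) ENNReal.one_ne_top).2 (nu_le_one 1)
    rwa [ENNReal.toReal_one] at this
  have hL : (0 : ℝ) < ((L + 1 : ℕ) : ℝ) := by positivity
  have h3 := p3_pos
  rw [← ENNReal.ofReal_toReal (kap_ne_top (L + 1))]
  refine ENNReal.ofReal_le_ofReal ?_
  rw [le_div_iff₀ (mul_pos h3 hL)]
  calc (kap (L + 1)).toReal * ((criticalProbI 3 : ℝ) ^ 3 * ((L + 1 : ℕ) : ℝ))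
      = ((L + 1 : ℕ) : ℝ) * (kap (L + 1)).toReal * (criticalProbI 3 : ℝ) ^ 3 := by ring
    _ ≤ 2 * (nu 1).toReal / (criticalProbI 3 : ℝ) ^ 3 * (criticalProbI 3 : ℝ) ^ 3 :=
        mul_le_mul_of_nonneg_right h h3.le
    _ = 2 * (nu 1).toReal := div_mul_cancel₀ _ h3.ne'
    _ ≤ 2 := by linarith

open KissDensity StubCensus in
/-- **The kissing density decays with exponent `3 - s`, given non-proliferation** (registered sub-goal
`stub_kissDensityDecay` of stmt-CriticalPhenomena-0911; the merger-density form "Â" of crux A): if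
`SubpolynomialBlocking` (stmt-CriticalPhenomena-4446) holds then for every `s > 0` there is `C` with
`E[1{U n-tall and U has a partner-kiss edge}/|U ∩ ∂ℍ|] ≤ C n^{s-3}` for all `n ≥ 1`.
Proof: `(N+1) κ_{2N} ≤ 2 ν_N/p_c³` (block estimate) and `ν_N ≤ C_s N^{s-2}` (`stub_tallDensity`). -/
theorem stub_kissDensityDecay :
    Summit.CriticalPhenomena.PercolationContinuityZ3.Theses.PercNonProliferation.SubpolynomialBlocking →
      ∀ s : ℝ, 0 < s → ∃ C : ℝ, ∀ n : ℕ, 1 ≤ n →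
        (∫⁻ ω, {ω | (∃ y : Site 3, (n : ℤ) ≤ y 0 ∧ ω ∈ openConnIn (halfSpace 3) 0 y) ∧
              ∃ q : Site 3 × Site 3, q.1 0 = 0 ∧ q.2 0 = 0 ∧ (zdGraph 3).Adj q.1 q.2 ∧
                ω ∈ openConnIn (halfSpace 3) 0 q.1 ∧ ω ∉ openConnIn (halfSpace 3) 0 q.2 ∧
                ∃ y : Site 3, (n : ℤ) ≤ y 0 ∧ ω ∈ openConnIn (halfSpace 3) q.2 y}.indicator
            (fun ω => (((halfSpaceFootprint ω : ℕ∞) : ENNReal))⁻¹) ω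
            ∂(bondPercolation (zdGraph 3) (criticalProbI 3))) ≤
          ENNReal.ofReal (C * (n : ℝ) ^ (s - 3)) := by
  intro hB s hs
  obtain ⟨Ct, hCt⟩ := stub_tallDensity hB s hs
  -- the real constant
  set p3 : ℝ := (criticalProbI 3 : ℝ) ^ 3 with hp3
  have h3 : 0 < p3 := p3_pos
  set F : ℝ := max ((3 : ℝ) ^ (3 - s)) 1 with hFdef
  have hF0 : 0 ≤ F := zero_le_one.trans (le_max_right _ _)
  set C : ℝ := max 1 (2 * max Ct 0 * F / p3) with hCdef
  have hC1 : 1 ≤ C := le_max_left _ _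
  have hC0 : 0 ≤ C := zero_le_one.trans hC1
  refine ⟨C, fun n hn => ?_⟩
  change kap n ≤ _
  rw [← ENNReal.ofReal_toReal (kap_ne_top n)]
  refine ENNReal.ofReal_le_ofReal ?_
  have hn0 : (0 : ℝ) < n := by exact_mod_cast hn
  -- κ_n ≤ 1 handles n = 1
  have hkap1 : (kap n).toReal ≤ 1 := by
    have := (ENNReal.toReal_le_toReal (kap_ne_top n) ENNReal.one_ne_top).2
      ((kap_le_nu n).trans (nu_le_one n))
    rwa [ENNReal.toReal_one] at this
  rcases Nat.lt_or_ge n 2 with hn2 | hn2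
  · have hn1 : n = 1 := by omega
    subst hn1
    calc (kap 1).toReal ≤ 1 := hkap1
      _ ≤ C * ((1 : ℕ) : ℝ) ^ (s - 3) := by rw [Nat.cast_one, Real.one_rpow, mul_one]; exact hC1
  -- n ≥ 2: N := n / 2 ≥ 1, n = 2N or 2N + 1, κ_n ≤ κ_{2N}
  set N : ℕ := n / 2 with hNdef
  have hN1 : 1 ≤ N := by omega
  have hN0 : (0 : ℝ) < N := by exact_mod_cast hN1
  have hnN : 2 * N ≤ n := by omega
  have hnN3 : (n : ℝ) ≤ 3 * N := by
    have : n ≤ 3 * N := by omega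
    exact_mod_cast this
  -- block estimate with L = N: (N+1) κ_{2N} ≤ 2 ν_N / p³
  have hblock := kap_toReal_le N N
  rw [show N + N = 2 * N by ring] at hblock
  -- ν_N ≤ Ct N^{s-2}
  have hnuN : (nu N).toReal ≤ max Ct 0 * (N : ℝ) ^ (s - 2) := by
    have h1 : nu N ≤ ENNReal.ofReal (Ct * (N : ℝ) ^ (s - 2)) := hCt N hN1
    have h2 := ENNReal.toReal_mono ENNReal.ofReal_ne_top h1
    refine h2.trans ?_
    rcases le_or_gt 0 (Ct * (N : ℝ) ^ (s - 2)) with h0 | h0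
    · rw [ENNReal.toReal_ofReal h0]
      exact mul_le_mul_of_nonneg_right (le_max_left _ _) (Real.rpow_nonneg hN0.le _)
    · rw [ENNReal.ofReal_of_nonpos h0.le, ENNReal.toReal_zero]
      exact mul_nonneg (le_max_right _ _) (Real.rpow_nonneg hN0.le _)
  -- κ_n ≤ κ_{2N}
  have hmono : (kap n).toReal ≤ (kap (2 * N)).toReal :=
    (ENNReal.toReal_le_toReal (kap_ne_top n) (kap_ne_top (2 * N))).2 (kap_antitone hnN)
  -- arithmetic
  have hNs : (N : ℝ) ^ (s - 2) = (N : ℝ) ^ (s - 3) * N := by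
    rw [show s - 2 = (s - 3) + 1 by ring, Real.rpow_add hN0, Real.rpow_one]
  have hkey : ((N + 1 : ℕ) : ℝ) * (kap (2 * N)).toReal ≤ 2 * (max Ct 0 * ((N : ℝ) ^ (s - 3) * N)) / p3 := by
    rw [← hNs]
    exact hblock.trans (div_le_div_of_nonneg_right (by linarith) h3.le)
  have hN1' : (N : ℝ) ≤ ((N + 1 : ℕ) : ℝ) := by push_cast; linarith
  have hk2N : (kap (2 * N)).toReal ≤ 2 * max Ct 0 * (N : ℝ) ^ (s - 3) / p3 := by
    have hk0 : 0 ≤ (kap (2 * N)).toReal := ENNReal.toReal_nonneg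
    have : (N : ℝ) * (kap (2 * N)).toReal ≤ (N : ℝ) * (2 * max Ct 0 * (N : ℝ) ^ (s - 3) / p3) := by
      calc (N : ℝ) * (kap (2 * N)).toReal ≤ ((N + 1 : ℕ) : ℝ) * (kap (2 * N)).toReal :=
            mul_le_mul_of_nonneg_right hN1' hk0
        _ ≤ 2 * (max Ct 0 * ((N : ℝ) ^ (s - 3) * N)) / p3 := hkey
        _ = (N : ℝ) * (2 * max Ct 0 * (N : ℝ) ^ (s - 3) / p3) := by ring
    exact le_of_mul_le_mul_left this hN0
  -- N^{s-3} ≤ F n^{s-3} with F := max (3^{3-s}) 1  (n ≤ 3N; the two cases s ≤ 3 / s > 3)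
  have hpow : (N : ℝ) ^ (s - 3) ≤ F * (n : ℝ) ^ (s - 3) := by
    have h1 : (n : ℝ) / 3 ≤ N := by rw [div_le_iff₀ (by norm_num : (0 : ℝ) < 3)]; linarith
    have h2 : 0 < (n : ℝ) / 3 := by positivity
    rcases le_or_gt (s - 3) 0 with hs3 | hs3
    · calc (N : ℝ) ^ (s - 3) ≤ ((n : ℝ) / 3) ^ (s - 3) :=
            Real.rpow_le_rpow_of_nonpos h2 h1 hs3
        _ = (3 : ℝ) ^ (3 - s) * (n : ℝ) ^ (s - 3) := by
            rw [Real.div_rpow hn0.le (by norm_num), div_eq_mul_inv, ← Real.rpow_neg (by norm_num), neg_sub,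
              mul_comm]
        _ ≤ F * (n : ℝ) ^ (s - 3) :=
            mul_le_mul_of_nonneg_right (le_max_left _ _) (Real.rpow_nonneg hn0.le _)
    · have hNn : (N : ℝ) ≤ n := by exact_mod_cast (show N ≤ n by omega)
      calc (N : ℝ) ^ (s - 3) ≤ (n : ℝ) ^ (s - 3) := Real.rpow_le_rpow hN0.le hNn hs3.le
        _ = 1 * (n : ℝ) ^ (s - 3) := (one_mul _).symm
        _ ≤ F * (n : ℝ) ^ (s - 3) :=
            mul_le_mul_of_nonneg_right (le_max_right _ _) (Real.rpow_nonneg hn0.le _)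
  have hmax0 : 0 ≤ 2 * max Ct 0 / p3 := div_nonneg (by positivity) h3.le
  calc (kap n).toReal ≤ (kap (2 * N)).toReal := hmono
    _ ≤ 2 * max Ct 0 * (N : ℝ) ^ (s - 3) / p3 := hk2N
    _ = (2 * max Ct 0 / p3) * (N : ℝ) ^ (s - 3) := by ring
    _ ≤ (2 * max Ct 0 / p3) * (F * (n : ℝ) ^ (s - 3)) :=
        mul_le_mul_of_nonneg_left hpow hmax0
    _ = (2 * max Ct 0 * F / p3) * (n : ℝ) ^ (s - 3) := by ring
    _ ≤ C * (n : ℝ) ^ (s - 3) :=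
        mul_le_mul_of_nonneg_right (le_max_right _ _) (Real.rpow_nonneg hn0.le _)

end Summit.CriticalPhenomena.PercolationContinuityZ3.Theorems.BoundaryTwoArmDecay

end
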